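import Mathlib
import Summits.NavierStokesRegularity.NavierStokesRegularity.Theorems.FilamentSkeletonRssSkeletonJ1RLiaSelfDerivZones
import Summits.NavierStokesRegularity.NavierStokesRegularity.Theorems.FilamentSkeletonRssSkeletonJ1RLiaSelfEnvelope

/-!
# Crux `SkeletonJ1R` (stmt-NavierStokesRegularity-23610) · line `streamline_kantorovich_R` · toward stub F2-d (`LiaDefectDerivBL`, v7), brick S3′ (outer zones) for B1′:
# ENVELOPE-ZONE AND FAR-ZONE MAJORANTS FOR THE SYMMETRIZED SELF-STRAND DERIVATIVE INTEGRAND of a curve with a LINEAR curvature envelope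

Hand `leafhand-ns-filamentskeletonrs-1` (gen 0), `--supports stmt-NavierStokesRegularity-23610 --as helper`.  MODEL rung, NEGATIVE side of the ladder:
kernel calculus for a HYPOTHETICAL filament-type blow-up skeleton; nothing here is a claim about Navier–Stokes regularity; the stub and the crux stay OPEN.

Derivative analogues of zones 2–3 of brick S3 (`…LiaSelfEnvelope.majorant_zone_envelope` / `majorant_zone_far`), for the symmetrized derivative integrand
`D(σ) = (−3⟪w, Δ⟫K₅(w))•X′σ×w + K₃(w)•(X′σ×Δ + X″σ×w)` (`w = Xτ − Xσ`, `Δ = X′τ − X′σ`, kernels `(‖w‖²+e²)^{−5/2}, (‖w‖²+e²)^{−3/2}`) of a unit-speed `C²` curve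
with envelope `‖X″σ‖ ≤ ε₀ + ε₁|σ|` and global tangent oscillation `θ ≤ 1` (chord `≥ |σ−τ|/2`), from the outer pointwise majorant
`‖D‖ ≤ 4‖Δ‖/‖w‖³ + ‖X″σ‖/‖w‖²` of `…LiaSelfDerivZones`:
* `majorant_zone_envelope_deriv` (`R < |σ−τ| ≤ L`, `κ0 ≥ ε₀ + ε₁|τ|`): `‖D(σ)‖ ≤ 36κ0/(σ−τ)² + 36ε₁/|σ−τ|` — integrates over the zone to
  `72κ0/R + 72ε₁ log(L/R)` (budget check for the LIA reference at collar points, `R ≍ √Γ`, `L ≍ ℓ`: `ℓΓκ0/√Γ ≍ Rb²√Γ` and `ℓΓε₁ log(ℓ/√Γ) ≍ ℓ log log Γ/log Γ`);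
* `majorant_zone_far_deriv` (`|σ−τ| > L`, global curvature ceiling `κm` — the LIA reference is straight outside `‖x‖² ≥ 3ℓ²`):
  `‖D(σ)‖ ≤ (64θ/L + 8κm)·(L² + (σ−τ)²)⁻¹`, a Cauchy tail integrating to `(64θ/L + 8κm)π/L`.
Together with the window majorant (`…LiaSelfDerivWindow`) and the frame (`…LiaSelfDerivFrame`) this is all the pointwise input of the derivative
local-induction estimate S3′; the remaining work is the zone integration (as in `…LiaSelfEnvelope.selfStrand_sub_lia_le`) and the reference inputs S4′.
-/

set_option linter.dupNamespace false -- `NavierStokesRegularity.NavierStokesRegularity` path/namespace repetition is the tree convention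

noncomputable section

namespace Summit.NavierStokesRegularity.NavierStokesRegularity.Theorems.SkeletonJ1RLiaSelf

open Set Function Filter Real Topology MeasureTheory
open Literature.Analysis.FluidPDE
open Summit.NavierStokesRegularity.NavierStokesRegularity.Theorems.SkeletonJ1RSlipTools (chord_arc_of_osc)
open scoped InnerProductSpace BigOperators

variable {X : ℝ → EuclideanSpace ℝ (Fin 3)}

/-- Chord `≥ |σ − τ|/2` from a global tangent oscillation `θ ≤ 1`. [folklore] -/
theorem half_abs_le_chord_of_osc (hX : ContDiff ℝ 2 X) (hunit : ∀ s, ‖deriv X s‖ = 1) {θ : ℝ} (hθ1 : θ ≤ 1)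
    (hosc : ∀ u v, ‖deriv X u - deriv X v‖ ≤ θ) (σ τ : ℝ) : (1 / 2 : ℝ) * |τ - σ| ≤ ‖X τ - X σ‖ := by
  have h := chord_arc_of_osc (hX.of_le (by norm_num)) hunit hosc τ σ
  have hθ0 : 0 ≤ θ := le_trans (norm_nonneg _) (hosc 0 0)
  have : (1 / 2 : ℝ) * |τ - σ| ≤ (1 - θ ^ 2 / 2) * |τ - σ| := mul_le_mul_of_nonneg_right (by nlinarith) (abs_nonneg _)
  exact this.trans h

/-- **Zone 2′ (envelope zone `R < |σ − τ| ≤ L`) for the derivative integrand.** [folklore] -/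
theorem majorant_zone_envelope_deriv (hX : ContDiff ℝ 2 X) (hunit : ∀ s, ‖deriv X s‖ = 1) {e : ℝ} (he : 0 < e)
    {τ σ R ε₀ ε₁ θ κ0 : ℝ} (hε₁ : 0 ≤ ε₁) (henv : ∀ σ, ‖deriv (deriv X) σ‖ ≤ ε₀ + ε₁ * |σ|)
    (hθ1 : θ ≤ 1) (hosc : ∀ u v, ‖deriv X u - deriv X v‖ ≤ θ) (hκ0 : ε₀ + ε₁ * |τ| ≤ κ0) (hR : 0 < R) (hσR : R < |σ - τ|) :
    ‖((-3 * ⟪X τ - X σ, deriv X τ - deriv X σ⟫_ℝ * ((‖X τ - X σ‖ ^ 2 + e ^ 2) ^ (5 / 2 : ℝ))⁻¹) • cross (deriv X σ) (X τ - X σ) +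
        ((‖X τ - X σ‖ ^ 2 + e ^ 2) ^ (3 / 2 : ℝ))⁻¹ • (cross (deriv X σ) (deriv X τ - deriv X σ) + cross (deriv (deriv X) σ) (X τ - X σ)))‖ ≤
      36 * κ0 / (σ - τ) ^ 2 + 36 * ε₁ / |σ - τ| := by
  have hs0 : 0 < |σ - τ| := hR.trans hσR
  have hs0' : 0 < |τ - σ| := by rwa [abs_sub_comm]
  have hτσ : τ ≠ σ := fun h => by rw [h, sub_self, abs_zero] at hs0'; exact lt_irrefl _ hs0'
  set κs := ε₀ + ε₁ * (|τ| + |σ - τ|) with hκs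
  have hκseg : ∀ p ∈ uIcc τ σ, ‖deriv (deriv X) p‖ ≤ κs := curvature_le_on_segment hε₁ henv τ σ
  have hκseg' : ∀ p ∈ uIcc σ τ, ‖deriv (deriv X) p‖ ≤ κs := fun p hp => hκseg p (uIcc_comm σ τ ▸ hp)
  have hκs0 : 0 ≤ κs := (norm_nonneg _).trans (hκseg τ left_mem_uIcc)
  -- inputs of the outer majorant: chord ≥ |s|/2, ‖Δ‖ ≤ κs|s|, ‖X″σ‖ ≤ κs
  have hchord : (1 / 2 : ℝ) * |τ - σ| ≤ ‖X τ - X σ‖ := half_abs_le_chord_of_osc hX hunit hθ1 hosc σ τ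
  have hΔ : ‖deriv X τ - deriv X σ‖ ≤ κs * |τ - σ| := norm_deriv_sub_deriv_le_on hX (τ := σ) (σ := τ) hκseg'
  have hb : ‖deriv (deriv X) σ‖ ≤ κs := hκseg σ right_mem_uIcc
  have h := norm_symmDerivIntegrand_le_of_chord (q := e ^ 2) (by positivity) (b := deriv (deriv X) σ) (P := deriv X τ) (w := X τ - X σ)
    (hunit σ) (by norm_num : (0:ℝ) < 1 / 2) hτσ hchord hΔ hb
  refine h.trans ?_
  -- 4κs|s|/((1/2)³|s|³) + κs/((1/2)²s²) = 36 κs/s² and κs/s² ≤ κ0/s² + ε₁/|s|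
  have hsq : (τ - σ) ^ 2 = |σ - τ| ^ 2 := by rw [← sq_abs, abs_sub_comm]
  have hs3 : |τ - σ| = |σ - τ| := abs_sub_comm _ _
  have heval : 4 * (κs * |τ - σ|) / ((1 / 2 : ℝ) ^ 3 * |τ - σ| ^ 3) + κs / ((1 / 2 : ℝ) ^ 2 * (τ - σ) ^ 2) = 36 * κs / |σ - τ| ^ 2 := by
    rw [hsq, hs3]; field_simp; ring
  rw [heval, show (σ - τ) ^ 2 = |σ - τ| ^ 2 from (sq_abs _).symm]
  have hsplit : 36 * κs / |σ - τ| ^ 2 = 36 * (ε₀ + ε₁ * |τ|) / |σ - τ| ^ 2 + 36 * ε₁ / |σ - τ| := by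
    rw [hκs]; field_simp; ring
  rw [hsplit]
  gcongr

/-- **Zone 3′ (far zone `|σ − τ| > L`) for the derivative integrand**, with a global curvature ceiling `κm`. [folklore] -/
theorem majorant_zone_far_deriv (hX : ContDiff ℝ 2 X) (hunit : ∀ s, ‖deriv X s‖ = 1) {e : ℝ} (he : 0 < e) {τ σ L θ κm : ℝ}
    (hθ1 : θ ≤ 1) (hosc : ∀ u v, ‖deriv X u - deriv X v‖ ≤ θ) (hκm : ∀ s, ‖deriv (deriv X) s‖ ≤ κm) (hL : 0 < L) (hσL : L < |σ - τ|) :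
    ‖((-3 * ⟪X τ - X σ, deriv X τ - deriv X σ⟫_ℝ * ((‖X τ - X σ‖ ^ 2 + e ^ 2) ^ (5 / 2 : ℝ))⁻¹) • cross (deriv X σ) (X τ - X σ) +
        ((‖X τ - X σ‖ ^ 2 + e ^ 2) ^ (3 / 2 : ℝ))⁻¹ • (cross (deriv X σ) (deriv X τ - deriv X σ) + cross (deriv (deriv X) σ) (X τ - X σ)))‖ ≤
      (64 * θ / L + 8 * κm) * (L ^ 2 + (σ - τ) ^ 2)⁻¹ := by
  have hs0 : 0 < |σ - τ| := hL.trans hσL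
  have hs0' : 0 < |τ - σ| := by rwa [abs_sub_comm]
  have hτσ : τ ≠ σ := fun h => by rw [h, sub_self, abs_zero] at hs0'; exact lt_irrefl _ hs0'
  have hθ0 : 0 ≤ θ := le_trans (norm_nonneg _) (hosc 0 0)
  have hκm0 : 0 ≤ κm := (norm_nonneg _).trans (hκm 0)
  have hchord : (1 / 2 : ℝ) * |τ - σ| ≤ ‖X τ - X σ‖ := half_abs_le_chord_of_osc hX hunit hθ1 hosc σ τ
  have h := norm_symmDerivIntegrand_le_of_chord (q := e ^ 2) (by positivity) (b := deriv (deriv X) σ) (P := deriv X τ) (w := X τ - X σ)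
    (hunit σ) (by norm_num : (0:ℝ) < 1 / 2) hτσ hchord (hosc τ σ) (hκm σ)
  refine h.trans ?_
  have hs3 : |τ - σ| = |σ - τ| := abs_sub_comm _ _
  have hsq : (τ - σ) ^ 2 = |σ - τ| ^ 2 := by rw [← sq_abs, abs_sub_comm]
  have heval : 4 * θ / ((1 / 2 : ℝ) ^ 3 * |τ - σ| ^ 3) + κm / ((1 / 2 : ℝ) ^ 2 * (τ - σ) ^ 2) = (32 * θ / |σ - τ| + 4 * κm) / |σ - τ| ^ 2 := by
    rw [hsq, hs3]; field_simp; ring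
  rw [heval, show (σ - τ) ^ 2 = |σ - τ| ^ 2 from (sq_abs _).symm]
  -- 32θ/|s| ≤ 32θ/L, and 1/s² ≤ 2/(L² + s²)
  have h1 : 32 * θ / |σ - τ| + 4 * κm ≤ 32 * θ / L + 4 * κm := by
    gcongr
  have hpos : 0 < |σ - τ| ^ 2 := by positivity
  have hpos2 : 0 < L ^ 2 + |σ - τ| ^ 2 := by positivity
  have hL2 : L ^ 2 ≤ |σ - τ| ^ 2 := pow_le_pow_left₀ hL.le hσL.le 2
  have h2 : (|σ - τ| ^ 2)⁻¹ ≤ 2 * (L ^ 2 + |σ - τ| ^ 2)⁻¹ := by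
    rw [show 2 * (L ^ 2 + |σ - τ| ^ 2)⁻¹ = 2 / (L ^ 2 + |σ - τ| ^ 2) by ring, ← one_div, div_le_div_iff₀ hpos hpos2]
    nlinarith
  have hnum0 : 0 ≤ 32 * θ / L + 4 * κm := by positivity
  calc (32 * θ / |σ - τ| + 4 * κm) / |σ - τ| ^ 2 ≤ (32 * θ / L + 4 * κm) / |σ - τ| ^ 2 := by gcongr
    _ = (32 * θ / L + 4 * κm) * (|σ - τ| ^ 2)⁻¹ := div_eq_mul_inv _ _
    _ ≤ (32 * θ / L + 4 * κm) * (2 * (L ^ 2 + |σ - τ| ^ 2)⁻¹) := mul_le_mul_of_nonneg_left h2 hnum0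
    _ = (64 * θ / L + 8 * κm) * (L ^ 2 + |σ - τ| ^ 2)⁻¹ := by ring

end Summit.NavierStokesRegularity.NavierStokesRegularity.Theorems.SkeletonJ1RLiaSelf

end
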